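import Mathlib.Analysis.InnerProductSpace.Basic
import Mathlib.Analysis.InnerProductSpace.LinearMap
import Mathlib.Analysis.Normed.Operator.Extend
import Mathlib.LinearAlgebra.Finsupp.LinearCombination
import HarnessLib

/-!
# Antiunitary operators from inner-product-reversing assignments on a total set

Topic `Literature/Analysis/OperatorTheory`. The Hilbert-space step in Streater–Wightman's
construction of the PCT operator `Θ` (1964, §3-4 Thm. 3-9 with §4-3 Thm. 4-7): `Θ` is *defined*
on the monomial vectors `φ(f₁) ⋯ φ(fₙ) Ω` by a formula, the PCT condition on the Wightman functions
says exactly that the assignment reverses inner products, and "`Θ` so defined extends by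
(anti)linearity and continuity to an antiunitary operator". Abstractly:

* `exists_antiunitary_extending` — if `v, θ : ι → H` are families in a complex Hilbert space whose
  spans are dense and `⟪θ i, θ j⟫ = ⟪v j, v i⟫` for all `i, j`, then there is an antiunitary
  (conjugate-linear isometric equivalence) `Θ : H ≃ₗᵢ⋆[ℂ] H` with `Θ (v i) = θ i`.
  (The antilinear extension to the span is well defined because it preserves norms of formal
  combinations; it extends to the closure by uniform continuity; its range is closed and contains
  the dense span of the `θ i`.)
* `antiunitary_apply_eq_of_generators` — an antiunitary intertwines two bounded operators as soon
  as it does so on a total family (used for `Θ U(a, A) = U(−a, A) Θ`).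

## References

* R. F. Streater, A. S. Wightman, *PCT, Spin and Statistics, and All That* (1964; Princeton 2000),
  §3-4 Thm. 3-9 (proof), §4-3 Thm. 4-7. [StreaterWightman1964]
-/

noncomputable section

open ComplexConjugate Complex
open scoped InnerProductSpace

namespace Literature.Analysis.OperatorTheory

variable {H : Type*} [NormedAddCommGroup H] [InnerProductSpace ℂ H] {ι : Type*}

/-! ### Formal combinations and their conjugate-linear images -/

/-- The linear realisation `c ↦ ∑ cᵢ vᵢ` of formal combinations. [folklore] -/
abbrev combL (v : ι → H) : (ι →₀ ℂ) →ₗ[ℂ] H := Finsupp.linearCombination ℂ v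

/-- The conjugate-linear realisation `c ↦ ∑ c̄ᵢ θᵢ` of formal combinations. [folklore] -/
def combA (θ : ι → H) (c : ι →₀ ℂ) : H := c.sum fun i a => conj a • θ i

/-- `combL` as a finite sum over the support. [folklore] -/
theorem combL_apply (v : ι → H) (c : ι →₀ ℂ) : combL v c = c.sum fun i a => a • v i :=
  Finsupp.linearCombination_apply ℂ c

/-- `combA` is additive. [folklore] -/
theorem combA_add (θ : ι → H) (c c' : ι →₀ ℂ) : combA θ (c + c') = combA θ c + combA θ c' :=
  Finsupp.sum_add_index' (fun i => by simp) (fun i a b => by simp [add_smul])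

/-- `combA` is conjugate-homogeneous. [folklore] -/
theorem combA_smul (θ : ι → H) (a : ℂ) (c : ι →₀ ℂ) : combA θ (a • c) = conj a • combA θ c := by
  unfold combA
  rw [Finsupp.sum_smul_index' (fun i => by simp), Finsupp.smul_sum]
  refine Finsupp.sum_congr fun i _ => ?_
  rw [smul_eq_mul, map_mul, mul_smul]

/-- `combA` of a difference. [folklore] -/
theorem combA_sub (θ : ι → H) (c c' : ι →₀ ℂ) : combA θ (c - c') = combA θ c - combA θ c' := by
  rw [sub_eq_add_neg, combA_add, ← neg_one_smul ℂ c', combA_smul, map_neg, map_one, neg_one_smul, ← sub_eq_add_neg]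

/-- `combA` on a single generator. [folklore] -/
theorem combA_single (θ : ι → H) (i : ι) : combA θ (Finsupp.single i 1) = θ i := by
  simp [combA, Finsupp.sum_single_index]

/-- **The conjugate-linear realisation preserves the norm of formal combinations** when the
assignment reverses inner products: `‖∑ c̄ᵢ θᵢ‖ = ‖∑ cᵢ vᵢ‖`. [cite: StreaterWightman1964, §3-4 Thm 3-9] -/
theorem inner_combA_self (v θ : ι → H) (hiso : ∀ i j, ⟪θ i, θ j⟫_ℂ = ⟪v j, v i⟫_ℂ) (c : ι →₀ ℂ) :
    ⟪combA θ c, combA θ c⟫_ℂ = ⟪combL v c, combL v c⟫_ℂ := by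
  rw [combL_apply]
  simp only [combA, Finsupp.sum, sum_inner, inner_sum, inner_smul_left, inner_smul_right, Complex.conj_conj, hiso,
    Finset.mul_sum]
  rw [Finset.sum_comm]
  refine Finset.sum_congr rfl fun j _ => Finset.sum_congr rfl fun i _ => ?_
  ring

/-- Norm form of `inner_combA_self`. [folklore] -/
theorem norm_combA (v θ : ι → H) (hiso : ∀ i j, ⟪θ i, θ j⟫_ℂ = ⟪v j, v i⟫_ℂ) (c : ι →₀ ℂ) :
    ‖combA θ c‖ = ‖combL v c‖ := by
  have h := inner_combA_self v θ hiso c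
  rw [inner_self_eq_norm_sq_to_K, inner_self_eq_norm_sq_to_K] at h
  have h' : (‖combA θ c‖ ^ 2 : ℝ) = ‖combL v c‖ ^ 2 := by exact_mod_cast h
  exact (pow_left_inj₀ (norm_nonneg _) (norm_nonneg _) two_ne_zero).1 h'

/-- The conjugate-linear realisation factors through the linear one. [folklore] -/
theorem combA_eq_of_combL_eq (v θ : ι → H) (hiso : ∀ i j, ⟪θ i, θ j⟫_ℂ = ⟪v j, v i⟫_ℂ) {c c' : ι →₀ ℂ}
    (h : combL v c = combL v c') : combA θ c = combA θ c' := by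
  rw [← sub_eq_zero, ← combA_sub, ← norm_eq_zero, norm_combA v θ hiso, map_sub, h, sub_self, norm_zero]

/-! ### The antilinear isometry on the span and its extension -/

section Construction

variable (v θ : ι → H) (hiso : ∀ i j, ⟪θ i, θ j⟫_ℂ = ⟪v j, v i⟫_ℂ)

/-- The antilinear isometry on the span of the `vᵢ` (the range of `combL`). [cite: StreaterWightman1964, §3-4 Thm 3-9] -/
def spanIsometry : LinearMap.range (combL v) →ₛₗᵢ[starRingEnd ℂ] H where
  toFun x := combA θ (Classical.choose x.2)
  map_add' x y := by
    have hx := Classical.choose_spec x.2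
    have hy := Classical.choose_spec y.2
    have hxy := Classical.choose_spec (x + y).2
    rw [← combA_add]
    refine combA_eq_of_combL_eq v θ hiso ?_
    rw [map_add]
    exact hxy.trans (by rw [hx, hy]; rfl)
  map_smul' a x := by
    have hx := Classical.choose_spec x.2
    have hax := Classical.choose_spec (a • x).2
    rw [← combA_smul]
    refine combA_eq_of_combL_eq v θ hiso ?_
    rw [map_smul]
    exact hax.trans (by rw [hx]; rfl)
  norm_map' x := by
    have hx := Classical.choose_spec x.2
    change ‖combA θ (Classical.choose x.2)‖ = ‖x‖
    rw [norm_combA v θ hiso, hx]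
    rfl

/-- The isometry on the span sends `∑ cᵢ vᵢ` to `∑ c̄ᵢ θᵢ`. [folklore] -/
theorem spanIsometry_apply_mk (c : ι →₀ ℂ) :
    spanIsometry v θ hiso ⟨combL v c, LinearMap.mem_range_self _ c⟩ = combA θ c := by
  change combA θ (Classical.choose _) = combA θ c
  exact combA_eq_of_combL_eq v θ hiso (Classical.choose_spec (⟨c, rfl⟩ : ∃ y, combL v y = combL v c))

variable [CompleteSpace H]

/-- The continuous antilinear extension to the whole space. [cite: StreaterWightman1964, §3-4 Thm 3-9] -/
def extension : H →SL[starRingEnd ℂ] H :=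
  (spanIsometry v θ hiso).toContinuousLinearMap.extend (LinearMap.range (combL v)).subtypeL

variable {v}

omit [CompleteSpace H] in
/-- The range of `combL v` is the span of the `vᵢ`; density transfers. [folklore] -/
theorem denseRange_subtypeL (hv : Dense (Submodule.span ℂ (Set.range v) : Set H)) :
    DenseRange ((LinearMap.range (combL v)).subtypeL) := by
  have hr : LinearMap.range (combL v) = Submodule.span ℂ (Set.range v) := Finsupp.range_linearCombination ℂ
  intro x
  have hx : x ∈ closure (Submodule.span ℂ (Set.range v) : Set H) := hv x
  rw [← hr] at hx
  convert hx using 2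
  ext y
  simp

omit [CompleteSpace H] in
/-- The inclusion of a subspace is uniformly inducing. [folklore] -/
theorem isUniformInducing_subtypeL (D : Submodule ℂ H) : IsUniformInducing D.subtypeL :=
  isUniformEmbedding_subtype_val.isUniformInducing

/-- The extension agrees with the span isometry. [folklore] -/
theorem extension_apply_coe (hv : Dense (Submodule.span ℂ (Set.range v) : Set H)) (x : LinearMap.range (combL v)) :
    extension v θ hiso ((LinearMap.range (combL v)).subtypeL x) = spanIsometry v θ hiso x :=
  ContinuousLinearMap.extend_eq (spanIsometry v θ hiso).toContinuousLinearMap (denseRange_subtypeL hv)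
    (isUniformInducing_subtypeL _) x

/-- The extension is isometric. [folklore] -/
theorem norm_extension (hv : Dense (Submodule.span ℂ (Set.range v) : Set H)) (x : H) : ‖extension v θ hiso x‖ = ‖x‖ := by
  refine (denseRange_subtypeL hv).induction_on (p := fun x => ‖extension v θ hiso x‖ = ‖x‖) x ?_ ?_
  · exact isClosed_eq ((extension v θ hiso).continuous.norm) continuous_norm
  · intro y
    rw [extension_apply_coe θ hiso hv y, (spanIsometry v θ hiso).norm_map, Submodule.subtypeL_apply, Submodule.coe_norm]

/-- The extension maps `vᵢ` to `θᵢ`. [folklore] -/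
theorem extension_apply_gen (hv : Dense (Submodule.span ℂ (Set.range v) : Set H)) (i : ι) : extension v θ hiso (v i) = θ i := by
  have hmem : v i ∈ LinearMap.range (combL v) := ⟨Finsupp.single i 1, by simp⟩
  have h := extension_apply_coe θ hiso hv ⟨v i, hmem⟩
  have key : spanIsometry v θ hiso ⟨v i, hmem⟩ = θ i := by
    have e : (⟨v i, hmem⟩ : LinearMap.range (combL v)) = ⟨combL v (Finsupp.single i 1), LinearMap.mem_range_self _ _⟩ :=
      Subtype.ext (by simp)
    rw [e, spanIsometry_apply_mk, combA_single]
  rw [Submodule.subtypeL_apply] at h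
  exact h.trans key

end Construction

/-! ### The theorem -/

/-- **An antiunitary operator from an inner-product-reversing assignment on total families**:
if the spans of `(vᵢ)` and `(θᵢ)` are dense and `⟪θᵢ, θⱼ⟫ = ⟪vⱼ, vᵢ⟫`, there is an antiunitary `Θ`
with `Θ vᵢ = θᵢ`. [cite: StreaterWightman1964, §3-4 Thm 3-9] -/
theorem exists_antiunitary_extending [CompleteSpace H] (v θ : ι → H)
    (hv : Dense (Submodule.span ℂ (Set.range v) : Set H)) (hθ : Dense (Submodule.span ℂ (Set.range θ) : Set H))
    (hiso : ∀ i j, ⟪θ i, θ j⟫_ℂ = ⟪v j, v i⟫_ℂ) :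
    ∃ Θ : H ≃ₗᵢ⋆[ℂ] H, ∀ i, Θ (v i) = θ i := by
  set T : H →ₛₗᵢ[starRingEnd ℂ] H :=
    { (extension v θ hiso).toLinearMap with norm_map' := norm_extension θ hiso hv } with hT
  have hTv : ∀ i, T (v i) = θ i := fun i => extension_apply_gen θ hiso hv i
  -- the range is closed and contains the dense span of the `θ i`
  have hclosed : IsClosed (Set.range T) := (T.isometry.isUniformInducing.isComplete_range).isClosed
  have hspan : (Submodule.span ℂ (Set.range θ) : Set H) ⊆ Set.range T := by
    intro x hx
    refine Submodule.span_induction (p := fun x _ => x ∈ Set.range T) ?_ ⟨0, map_zero T⟩ ?_ ?_ hx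
    · rintro _ ⟨i, rfl⟩; exact ⟨v i, hTv i⟩
    · rintro x y _ _ ⟨a, rfl⟩ ⟨b, rfl⟩; exact ⟨a + b, map_add T a b⟩
    · rintro a x _ ⟨b, rfl⟩; exact ⟨conj a • b, by rw [map_smulₛₗ, Complex.conj_conj]⟩
  have hsurj : Function.Surjective T := by
    intro y
    have hy : y ∈ Set.range T := by
      rw [← hclosed.closure_eq]
      exact closure_mono hspan (hθ y)
    exact hy
  exact ⟨LinearIsometryEquiv.ofSurjective T hsurj, fun i => hTv i⟩

/-- **An antiunitary intertwines two bounded operators if it does so on a total family.**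
[cite: StreaterWightman1964, §3-4 Thm 3-9] -/
theorem antiunitary_apply_eq_of_generators (Θ : H ≃ₗᵢ⋆[ℂ] H) (U U' : H →L[ℂ] H) (v : ι → H)
    (hv : Dense (Submodule.span ℂ (Set.range v) : Set H)) (h : ∀ i, Θ (U (v i)) = U' (Θ (v i))) (x : H) :
    Θ (U x) = U' (Θ x) := by
  set A : H →SL[starRingEnd ℂ] H := (Θ.toLinearIsometry.toContinuousLinearMap).comp U with hA
  set B : H →SL[starRingEnd ℂ] H := U'.comp Θ.toLinearIsometry.toContinuousLinearMap with hB
  have hAB : A = B := ContinuousLinearMap.ext_on hv (by rintro _ ⟨i, rfl⟩; exact h i)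
  have := congrArg (fun T : H →SL[starRingEnd ℂ] H => T x) hAB
  exact this

end Literature.Analysis.OperatorTheory
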